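/-
Copyright: cell `langlands-arthur-audit` (papers/Langlands/langlands-arthur-audit), unit `pub-arthur-carver` (gen 7).
Staged for the tree under `Literature/NumberTheory/Automorphic/` (LEAN-IN-TREE rule 2026-08-18).  Generic,
type-polymorphic form of the Boolean clause-checking kit that `Arthur2013/LeafSupport.lean` (p179578) carries
monomorphically; imported by `Mok2015/LeafSupport.lean` and `KMSW2014/LeafSupport.lean`.  No mathematics of
automorphic forms; no import beyond `Init`.
-/

/-!
# Leaf-support kit: Horn clauses over a bit-valuation, checked by `decide`

Shared bookkeeping for the leaf-support certificates of the cell's dependency DAGs (Arthur 2013, Mok 2015,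
Kaletha–Mínguez–Shin–White 2014).  An "atom" type `α` comes with a bit position `idx : α → Nat`; a valuation
is a numeral `v : Nat`, atom `a` holding iff bit `idx a` of `v` is set (`bit idx v a`).  `allP` / `allB` and
`noneP` / `noneB` are the propositional and Boolean readings of "every / no atom of a list holds", `okE` is the
Boolean check of one Horn clause "premises ⟹ conclusions", and `sound` turns a passed check into the
implication between the propositional readings.  Everything here is closed or uses only `propext`.
-/

namespace Literature.NumberTheory.Automorphic.LeafSupportKit

variable {α : Type}

/-- Atom `a` holds in the valuation numeral `v`: bit `idx a` is set. [folklore] (bookkeeping) -/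
abbrev bit (idx : α → Nat) (v : Nat) (a : α) : Prop := v.testBit (idx a) = true

/-- All atoms of a list hold (as a right-nested conjunction). [folklore] (bookkeeping) -/
def allP (P : α → Prop) : List α → Prop
  | [] => True
  | a :: l => P a ∧ allP P l

/-- Boolean form of `allP (bit idx v)`. [folklore] (bookkeeping) -/
def allB (idx : α → Nat) (v : Nat) : List α → Bool
  | [] => true
  | a :: l => v.testBit (idx a) && allB idx v l

/-- `allP (bit idx v) l ↔ allB idx v l`. [folklore] (bookkeeping) -/
theorem allP_iff_allB (idx : α → Nat) (v : Nat) :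
    ∀ l : List α, allP (bit idx v) l ↔ allB idx v l = true
  | [] => by simp [allP, allB]
  | a :: l => by simp [allP, allB, bit, allP_iff_allB idx v l]

/-- No atom of the list holds. [folklore] (bookkeeping) -/
def noneP (P : α → Prop) : List α → Prop
  | [] => True
  | a :: l => ¬ P a ∧ noneP P l

/-- Boolean form of `noneP (bit idx v)`. [folklore] (bookkeeping) -/
def noneB (idx : α → Nat) (v : Nat) : List α → Bool
  | [] => true
  | a :: l => !(v.testBit (idx a)) && noneB idx v l

/-- `noneB` is sound for `noneP (bit idx v)`. [folklore] (bookkeeping) -/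
theorem noneP_of_noneB (idx : α → Nat) (v : Nat) :
    ∀ l : List α, noneB idx v l = true → noneP (bit idx v) l
  | [], _ => trivial
  | a :: l, h => by
    simp [noneB] at h
    exact ⟨by simp [bit, h.1], noneP_of_noneB idx v l h.2⟩

/-- The Horn clause "premises ⟹ conclusions" holds in the valuation `v`. [folklore] (bookkeeping) -/
def okE (idx : α → Nat) (v : Nat) (ps cs : List α) : Bool := !(allB idx v ps) || allB idx v cs

/-- Soundness of the clause check. [folklore] (bookkeeping) -/
theorem sound {idx : α → Nat} {v : Nat} {ps cs : List α} (h : okE idx v ps cs = true)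
    (hp : allP (bit idx v) ps) : allP (bit idx v) cs := by
  have hp' := (allP_iff_allB idx v ps).1 hp
  simp [okE, hp'] at h
  exact (allP_iff_allB idx v cs).2 h

end Literature.NumberTheory.Automorphic.LeafSupportKit
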